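import Literature.AnabelianGeometry.EtaleTheta.ClassicalTheta
import Summits.ABC.IUTFork.Repair.RHReqsideWeightLaws
import Mathlib.Analysis.Normed.Ring.Ultra
import Mathlib.Analysis.Normed.Group.Ultra
import HarnessLib

/-!
# R-H ROUND 4 · R4-3 critic faces for the LENS-1 cards `isogenous-theta-first-power` / `cusp-residue-law` (rh4-crit-1)

Kernel faces used in `ROUND4/IDEAS/crit-isogenous-theta-first-power-rh4-crit-1.md` and
`crit-cusp-residue-law-rh4-crit-1.md`. Cell-currency arithmetic and [EtTh] §1 series facts only; no `def … : Prop`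
hypothesis, no Literature fact, no instance; nothing here asserts anything about abc or about [IUTchIII] Cor 3.12.

* `iso_dominant_gap` — the exponent bookkeeping behind the card's law: for `0 < j < l` and `n ≠ −1`,
  `−j < l·n(n+1) + (2n+1)·j` (indeed the difference is `(n+1)(l·n + 2j)`), i.e. the term `n = −1` of
  `Θ̈_{q̈^l}(ζ q̈^j)` is the UNIQUE term of minimal valuation `−j·ord(q̈)`.
* `thetaDdotTerm_neg_one` — that dominant term is `−Ü⁻¹`: at print's label points the isogenous theta IS the inverse
  COORDINATE up to a 1-unit (value level).
* `norm_thetaDdot_eq_norm_inv_of_gap` / `norm_isoTheta` — R-A1 of the card in the kernel: in a complete ultrametric field,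
  `‖q̈‖ < 1`, `‖ζ‖ = 1`, `0 < j < l` ⇒ `‖Θ̈_{q̈^l}(q̈^j·ζ)‖ = ‖q̈‖^{−j}` (law `|j|`, first power, same points).
* `orbitLaw_l5/7/11/13` — print's law is the `F_l`-ORBIT SUM of the card's law: `Σ_{t<l} |j − t| = j² − (l−1)j + l(l−1)/2`
  (`decide`), i.e. `q^{j²}` is the norm over the `l` cusp-translates of the isogenous theta, up to a coordinate power.
* `jacobiTrunc_law_le_lawPow3_l13/_l107` (+ `jacobiTrunc_cert_*`, `lawPow3_sandwich`) — truncated Jacobi products `(Ü − Ü⁻¹)·∏_{i∈S}(1 − q̈^{2i}Ü²)(1 − q̈^{2i}Ü⁻²)` have the EVEN,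
  POLE-FREE law `f_S(j) = j + 2·Σ_{i∈S, i<j}(j − i)`; with `S = {2, 6}` (l = 13) resp. `S = {2,7,16,29,45,53}` (l = 107) this law is
  `≤ lawPow 3 = ⌈j^{3/2}⌉` at every label and within `1` resp. `5` of it — so the κ′ = 3/2 door's EXACT engine law has no pole-free
  single-function realisation (id-1: `Δ² = −1` at `j = 3`), but its demand CLASS is dominated from below by realisable function laws.
-/

namespace Summit.ABC.IUTFork.Repair.RH.IsoThetaFaces

open Literature.AnabelianGeometry.EtaleTheta IsUltrametricDist
open Summit.ABC.IUTFork.Repair.RH.ReqsideWeightLaws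

/-! ## 1. Exponent bookkeeping: the unique dominant term -/

/-- `h(n) − h(−1) = (n+1)(l·n + 2j)` for `h(n) = l·n(n+1) + (2n+1)j`. [folklore] -/
theorem gap_factor (l j n : ℤ) :
    l * (n * (n + 1)) + (2 * n + 1) * j - (-j) = (n + 1) * (l * n + 2 * j) := by ring

/-- DOMINANT-TERM FACE: for `0 < j < l` and `n ≠ −1` the valuation exponent of the `n`-th term of `Θ̈_{q̈^l}(ζ q̈^j)`
exceeds that of the term `n = −1` (which is `−j`). [folklore] -/
theorem iso_dominant_gap {l j n : ℤ} (hj : 0 < j) (hjl : j < l) (hn : n ≠ -1) :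
    -j < l * (n * (n + 1)) + (2 * n + 1) * j := by
  have key : 0 < (n + 1) * (l * n + 2 * j) := by
    rcases lt_or_gt_of_ne hn with h | h
    · have h1 : n + 1 < 0 := by omega
      have h2 : l * n + 2 * j < 0 := by nlinarith
      exact mul_pos_of_neg_of_neg h1 h2
    · have h1 : 0 < n + 1 := by omega
      have h2 : 0 < l * n + 2 * j := by nlinarith
      exact mul_pos h1 h2
  linarith [gap_factor l j n]

/-- Integer form used for norms: `−j + 1 ≤ exponent`. [folklore] -/
theorem iso_dominant_gap' {l j n : ℤ} (hj : 0 < j) (hjl : j < l) (hn : n ≠ -1) :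
    -j + 1 ≤ l * (n * (n + 1)) + (2 * n + 1) * j := by
  have := iso_dominant_gap hj hjl hn; omega

/-- At the boundary `j = l` uniqueness fails: the terms `n = −1` and `n = −2` tie (the first kink of the Newton polygon of the
isogenous theta sits at label `l`, outside the label range `1 … l⋆`). [folklore] -/
theorem iso_tie_at_period (l : ℤ) : l * ((-2 : ℤ) * (-2 + 1)) + (2 * (-2) + 1) * l = -l := by ring

variable {𝕜 : Type*} [NormedField 𝕜]

/-- VALUE = INVERSE COORDINATE: the dominant term is `−Ü⁻¹`, whatever the period. [folklore] -/
theorem thetaDdotTerm_neg_one (Q U : 𝕜) : thetaDdotTerm Q U (-1) = -U⁻¹ := by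
  simp [thetaDdotTerm, Int.negOnePow_neg, Int.negOnePow_one]

/-! ## 2. R-A1 in the kernel: `‖Θ̈_{q̈^l}(q̈^j ζ)‖ = ‖q̈‖^{−j}` -/

/-- General dominant-term lemma: if every term other than `n = −1` has norm `≤ C < ‖Ü‖⁻¹`, then `‖Θ̈_Q(Ü)‖ = ‖Ü‖⁻¹`
(complete ultrametric field, `‖Q‖ < 1`). [folklore] -/
theorem norm_thetaDdot_eq_norm_inv_of_gap [CompleteSpace 𝕜] [IsUltrametricDist 𝕜] {Q U : 𝕜} {C : ℝ}
    (hQ : ‖Q‖ < 1) (hC : ∀ n : ℤ, n ≠ -1 → ‖thetaDdotTerm Q U n‖ ≤ C) (hCU : C < ‖U‖⁻¹) :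
    ‖thetaDdot Q U‖ = ‖U‖⁻¹ := by
  classical
  have hs : Summable (thetaDdotTerm Q U) := summable_thetaDdotTerm hQ U
  have h1 := hs.tsum_eq_add_tsum_ite (-1)
  set T : 𝕜 := ∑' n : ℤ, if n = -1 then 0 else thetaDdotTerm Q U n with hT
  have hC0 : 0 ≤ C := le_trans (norm_nonneg _) (hC 0 (by norm_num))
  have hTle : ‖T‖ ≤ C := by
    refine IsUltrametricDist.norm_tsum_le_of_forall_le_of_nonneg hC0 fun n => ?_
    by_cases hn : n = -1
    · simp [hn, hC0]
    · simp only [hn, if_false]; exact hC n hn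
  have hdom : ‖thetaDdotTerm Q U (-1)‖ = ‖U‖⁻¹ := by rw [thetaDdotTerm_neg_one, norm_neg, norm_inv]
  have hlt : ‖T‖ < ‖thetaDdotTerm Q U (-1)‖ := by rw [hdom]; exact lt_of_le_of_lt hTle hCU
  unfold thetaDdot
  rw [h1, IsUltrametricDist.norm_add_eq_max_of_norm_ne_norm (ne_of_gt hlt), max_eq_left hlt.le, hdom]

/-- Norm of the `n`-th term at parameter `q̈^l` and point `q̈^j·ζ`, `‖ζ‖ = 1`. [folklore] -/
theorem norm_isoThetaTerm {q2 ζ : 𝕜} (hq0 : q2 ≠ 0) (hζ : ‖ζ‖ = 1) (l : ℕ) (j n : ℤ) :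
    ‖thetaDdotTerm (q2 ^ l) (q2 ^ j * ζ) n‖ = ‖q2‖ ^ ((l : ℤ) * (n * (n + 1)) + (2 * n + 1) * j) := by
  have hq : (‖q2‖ : ℝ) ≠ 0 := norm_ne_zero_iff.mpr hq0
  rw [norm_thetaDdotTerm, norm_mul, hζ, mul_one, norm_pow, norm_zpow, ← zpow_natCast, ← zpow_mul, ← zpow_mul,
    ← zpow_add₀ hq]
  congr 1; ring

/-- **R-A1 (card `isogenous-theta-first-power`) in the kernel**: `‖Θ̈_{q̈^l}(q̈^j·ζ)‖ = ‖q̈‖^{−j}` for `0 < j < l`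
— the FIRST-POWER law at print's label points (complete ultrametric field, `0 < ‖q̈‖ < 1`, `‖ζ‖ = 1`). [folklore] -/
theorem norm_isoTheta [CompleteSpace 𝕜] [IsUltrametricDist 𝕜] {q2 ζ : 𝕜} (hq : ‖q2‖ < 1) (hq0 : q2 ≠ 0)
    (hζ : ‖ζ‖ = 1) {l : ℕ} {j : ℤ} (hj : 0 < j) (hjl : j < l) :
    ‖thetaDdot (q2 ^ l) (q2 ^ j * ζ)‖ = ‖q2‖ ^ (-j) := by
  have hqpos : 0 < ‖q2‖ := norm_pos_iff.mpr hq0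
  have hl : l ≠ 0 := by rintro rfl; simp at hjl; omega
  have hQ : ‖q2 ^ l‖ < 1 := by rw [norm_pow]; exact pow_lt_one₀ (norm_nonneg _) hq hl
  have hnormU : ‖q2 ^ j * ζ‖⁻¹ = ‖q2‖ ^ (-j) := by rw [norm_mul, hζ, mul_one, norm_zpow, zpow_neg]
  rw [← hnormU]
  refine norm_thetaDdot_eq_norm_inv_of_gap (C := ‖q2‖ ^ (-j + 1)) hQ (fun n hn => ?_) ?_
  · rw [norm_isoThetaTerm hq0 hζ]
    exact zpow_le_zpow_right_of_le_one₀ hqpos hq.le (iso_dominant_gap' hj hjl hn)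
  · rw [hnormU]; exact zpow_lt_zpow_right_of_lt_one₀ hqpos hq (by omega)

/-- Evenness at the value level follows from the tree's `thetaDdot_inv`/`thetaDdot_neg`; here the law-level statement for `j < 0`:
`‖Θ̈_{q̈^l}(q̈^j·ζ)‖ = ‖q̈‖^{−|j|}` for `0 < |j| < l`, via `Ü ↦ Ü⁻¹`. [folklore] -/
theorem norm_isoTheta_abs [CompleteSpace 𝕜] [IsUltrametricDist 𝕜] {q2 ζ : 𝕜} (hq : ‖q2‖ < 1) (hq0 : q2 ≠ 0)
    (hζ : ‖ζ‖ = 1) {l : ℕ} {j : ℤ} (hj : j ≠ 0) (hjl : |j| < l) :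
    ‖thetaDdot (q2 ^ l) (q2 ^ j * ζ)‖ = ‖q2‖ ^ (-|j|) := by
  rcases lt_or_gt_of_ne hj with h | h
  · have hζ0 : ζ ≠ 0 := by rintro rfl; simp at hζ
    have hrw : q2 ^ j * ζ = (q2 ^ (-j) * ζ⁻¹)⁻¹ := by rw [mul_inv, inv_inv, zpow_neg, inv_inv]
    rw [hrw, thetaDdot_inv, norm_neg, abs_of_neg h]
    exact norm_isoTheta hq hq0 (by rw [norm_inv, hζ, inv_one]) (by omega) (by rw [abs_of_neg h] at hjl; exact hjl)
  · rw [abs_of_pos h]; exact norm_isoTheta hq hq0 hζ h (by rw [abs_of_pos h] at hjl; exact hjl)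

/-! ## 3. Print's law is the orbit-sum of the card's law (norm over the `l` cusp-translates) -/

/-- The orbit sum `Σ_{t<l} |j − t|` of the isogenous law over the `l` cusp-translates. [folklore] -/
def orbitLaw (l j : ℕ) : ℤ := ((List.range l).map (fun t => |(j : ℤ) - (t : ℤ)|)).sum

/-- `Σ_{t<5} |j − t| = j² − 4j + 10` for `j < 5`. [folklore] -/
theorem orbitLaw_l5 : ∀ j : ℕ, j < 5 → orbitLaw 5 j = (j : ℤ) ^ 2 - 4 * j + 10 := by decide
/-- `Σ_{t<7} |j − t| = j² − 6j + 21` for `j < 7`. [folklore] -/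
theorem orbitLaw_l7 : ∀ j : ℕ, j < 7 → orbitLaw 7 j = (j : ℤ) ^ 2 - 6 * j + 21 := by decide
/-- `Σ_{t<11} |j − t| = j² − 10j + 55` for `j < 11`. [folklore] -/
theorem orbitLaw_l11 : ∀ j : ℕ, j < 11 → orbitLaw 11 j = (j : ℤ) ^ 2 - 10 * j + 55 := by decide
/-- `Σ_{t<13} |j − t| = j² − 12j + 78` for `j < 13`: print's `j²` = orbit sum of `|j − t|` up to the affine (coordinate-power) term. [folklore] -/
theorem orbitLaw_l13 : ∀ j : ℕ, j < 13 → orbitLaw 13 j = (j : ℤ) ^ 2 - 12 * j + 78 := by decide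

/-! ## 4. Truncated Jacobi products: even, pole-free laws between `|j|` and `j²` -/

/-- Law of the truncated Jacobi product with zero pairs over the labels in `S ∪ {0}`:
`f_S(j) = j + 2·Σ_{i∈S, i<j} (j − i)` (cell units `m_q`, `M = l`; natural-number valued). [folklore] -/
def jacobiTruncLaw (S : List ℕ) (j : ℕ) : ℕ :=
  j + 2 * ((S.filter (· < j)).map (fun i => j - i)).sum

/-- `S = ∅`: the coordinate-class law `j` (= `lawPow 2`, tree `lawPow_two`). [folklore] -/
theorem jacobiTruncLaw_nil (j : ℕ) : (jacobiTruncLaw [] j : ℤ) = lawPow 2 j := by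
  simp [jacobiTruncLaw, lawPow_two]

/-- `S = {1, …, 6}` at `l = 13`: print's law `j²` on the label range (all zero pairs present). [folklore] -/
theorem jacobiTruncLaw_full_l13 : ∀ j : ℕ, j ≤ 6 → jacobiTruncLaw [1, 2, 3, 4, 5, 6] j = j ^ 2 := by decide

/-- `l = 13`, `S = {2, 6}`: values `(1,2,5,8,11,14)`. [folklore] -/
theorem jacobiTruncLaw_l13_values :
    (List.range 6).map (fun i => jacobiTruncLaw [2, 6] (i + 1)) = [1, 2, 5, 8, 11, 14] := by decide

/-- Square-free certificate at `l = 13`: `(f_S(j) − 1)² < j³ ≤ (f_S(j) + 1)²` for `1 ≤ j ≤ 6`, i.e. `f_S ≤ ⌈j^{3/2}⌉ ≤ f_S + 1`. [folklore] -/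
theorem jacobiTrunc_cert_l13 :
    ∀ j : ℕ, j ≤ 6 → 1 ≤ j → (jacobiTruncLaw [2, 6] j - 1) ^ 2 < j ^ 3 ∧ j ^ 3 ≤ (jacobiTruncLaw [2, 6] j + 1) ^ 2 := by
  decide

/-- Square-free certificate at `l = 107`, `S = {2,7,16,29,45,53}`: `(f_S(j) − 1)² < j³ ≤ (f_S(j) + 5)²` for `1 ≤ j ≤ 53`
(`Σ_{j≤53} f_S = 8323` vs `Σ ⌈j^{3/2}⌉ = 8398`). [folklore] -/
theorem jacobiTrunc_cert_l107 :
    ∀ j : ℕ, j ≤ 53 → 1 ≤ j → (jacobiTruncLaw [2, 7, 16, 29, 45, 53] j - 1) ^ 2 < j ^ 3 ∧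
      j ^ 3 ≤ (jacobiTruncLaw [2, 7, 16, 29, 45, 53] j + 5) ^ 2 := by
  decide

/-- From the certificates to the engine law: `f ≤ lawPow 3 j ≤ f + k`. [folklore] -/
theorem lawPow3_sandwich {j f k : ℕ} (hf : 1 ≤ f) (h1 : (f - 1) ^ 2 < j ^ 3) (h2 : j ^ 3 ≤ (f + k) ^ 2) :
    (f : ℤ) ≤ lawPow 3 j ∧ lawPow 3 j ≤ (f : ℤ) + k := by
  refine ⟨?_, ?_⟩
  · have h := succ_le_lawPow_of_sq_lt (a := 3) h1
    have : ((f - 1 : ℕ) : ℤ) = (f : ℤ) - 1 := by push_cast [Nat.cast_sub hf]; ring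
    rw [this] at h; linarith
  · have h := lawPow_le_of_pow_le_sq (a := 3) h2
    push_cast at h; exact h

/-- **EVEN POLE-FREE FUNCTION LAWS UNDER THE κ′ = 3/2 DOOR (l = 13)**: `f_{2,6}(j) ≤ lawPow 3 j ≤ f_{2,6}(j) + 1`, `1 ≤ j ≤ 6`. [folklore] -/
theorem jacobiTrunc_law_le_lawPow3_l13 {j : ℕ} (hj : 1 ≤ j) (hj' : j ≤ 6) :
    (jacobiTruncLaw [2, 6] j : ℤ) ≤ lawPow 3 j ∧ lawPow 3 j ≤ (jacobiTruncLaw [2, 6] j : ℤ) + (1 : ℕ) := by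
  obtain ⟨h1, h2⟩ := jacobiTrunc_cert_l13 j hj' hj
  exact lawPow3_sandwich (by unfold jacobiTruncLaw; omega) h1 h2

/-- **EVEN POLE-FREE FUNCTION LAWS UNDER THE κ′ = 3/2 DOOR (l = 107)**: `f_S(j) ≤ lawPow 3 j ≤ f_S(j) + 5`, `1 ≤ j ≤ 53`,
`S = {2,7,16,29,45,53}` (zero pairs over 7 of the 54 label circles `0 … 53`). [folklore] -/
theorem jacobiTrunc_law_le_lawPow3_l107 {j : ℕ} (hj : 1 ≤ j) (hj' : j ≤ 53) :
    (jacobiTruncLaw [2, 7, 16, 29, 45, 53] j : ℤ) ≤ lawPow 3 j ∧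
      lawPow 3 j ≤ (jacobiTruncLaw [2, 7, 16, 29, 45, 53] j : ℤ) + (5 : ℕ) := by
  obtain ⟨h1, h2⟩ := jacobiTrunc_cert_l107 j hj' hj
  exact lawPow3_sandwich (by unfold jacobiTruncLaw; omega) h1 h2

/-- Second difference of `f_S` is `2·[j ∈ S] ∈ {0, 2}` — pole-free, zeros in pairs (checked on the `l = 107` label range). [folklore] -/
theorem jacobiTrunc_secondDiff_l107 :
    ∀ j : ℕ, j ≤ 53 → 1 ≤ j → (jacobiTruncLaw [2, 7, 16, 29, 45, 53] (j + 1) + jacobiTruncLaw [2, 7, 16, 29, 45, 53] (j - 1)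
      = 2 * jacobiTruncLaw [2, 7, 16, 29, 45, 53] j + if j ∈ [2, 7, 16, 29, 45, 53] then 2 else 0) := by
  decide

end Summit.ABC.IUTFork.Repair.RH.IsoThetaFaces
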